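import Summits.Ventures.PercRepro.Night2DiagonalReduction

/-!
# PercRepro — the diagonal of the shadow form from `q = 3` on, modulo the fat local forms for `q′ ≥ 4`
(night-2, gen 11)

`shadowHall_diag_of_local_fat_simple` starts its induction at `q = 1`; since the rows `q = 2` (gen 7) and
`q = 3` (this gen, `shadowHall_five_three_phiK`) are theorems on every matroid, the induction may start at
`q = 3`, and the residual hypothesis is the fat local form for `4 ≤ q′ ≤ q` only:

* **`shadowHall_diag_of_local_fat_simple_three`**: for `3 ≤ q`, if the local form holds at every rank-`(q′+1)`
  flat with `2 ≤ |E ∖ G| ≤ q′` of every loopless simple matroid of rank `q′ + 2` for `4 ≤ q′ ≤ q`, then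
  `ShadowHall M (q + 2) q ((q+2)/(q+1))` for every finite matroid.  (For `q′ ≤ 6` the regime `|E ∖ G| = q′`
  is itself a theorem, `Night2LocalDQFour` / `DQFive` / `DQSix`.)
-/

open scoped Matroid

namespace PercRepro.Shadow

open Finset PerFlat ThmH

variable {α : Type} [DecidableEq α]

/-- **The diagonal from `q = 3` on**: the residual is the fat local form of loopless simple matroids for
`4 ≤ q′ ≤ q`. -/
theorem shadowHall_diag_of_local_fat_simple_three (q : ℕ) (hq : 3 ≤ q)
    (hloc : ∀ q', 4 ≤ q' → q' ≤ q → ∀ (N : Matroid α) [N.Finite],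
      (∀ e ∈ gr N, ∀ f ∈ gr N, e ≠ f → rkN N {e, f} = 2) → (∀ e ∈ gr N, N.Indep {e}) →
      N.eRank = ((q' + 2 : ℕ) : ℕ∞) →
      ∀ G ∈ flatsQ N (q' + 1), 2 ≤ (gr N \ G).card → (gr N \ G).card ≤ q' → LocalShadowHall N q' G)
    (M : Matroid α) [M.Finite] : ShadowHall M (q + 2) q (((q : ℚ) + 2) / ((q : ℚ) + 1)) := by
  induction q, hq using Nat.le_induction generalizing M with
  | base =>
    have h := shadowHall_five_three_phiK M
    rw [phiK_five_three_ratio] at h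
    exact h
  | succ n hn ih =>
    have hrank : ∀ (N : Matroid α) [N.Finite], N.eRank = ((n + 1 + 2 : ℕ) : ℕ∞) →
        ShadowHall N (n + 1 + 2) (n + 1) ((((n + 1 : ℕ) : ℚ) + 2) / (((n + 1 : ℕ) : ℚ) + 1)) := by
      intro N _ hN
      refine shadowHall_diag_of_simple (q := n + 1) (by omega) ?_ ?_ N hN
      · intro N' _
        have h := ih (fun q' h4 hq' => hloc q' h4 (by omega)) N'
        have hc : (((n : ℚ) + 2) / ((n : ℚ) + 1)) = ((((n + 1 : ℕ) : ℚ)) + 1) / ((n + 1 : ℕ) : ℚ) := by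
          push_cast; ring
        rw [hc] at h
        have heq : n + 1 - 1 = n := by omega
        rw [heq]
        exact h
      · intro N' _ hN' hs
        have hl : ∀ e ∈ gr N', N'.Indep {e} :=
          indep_singleton_of_simple_of_two_le hs (by rw [hN']; exact_mod_cast (by omega : 2 ≤ n + 1 + 2))
        have hrk : N'.eRk ((gr N' : Finset α) : Set α) = ((n + 1 + 2 : ℕ) : ℕ∞) := by
          rw [coe_gr, Matroid.eRk_ground]; exact hN'
        apply shadowHall_of_local_fat (q := n + 1) hrk
        intro G hG h2 hd
        exact hloc (n + 1) (by omega) le_rfl N' hs hl hN' G hG h2 hd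
    by_cases hlt : M.eRank < ((n + 1 + 2 : ℕ) : ℕ∞)
    · exact shadowHall_of_Uq_empty (Uq_eq_empty_of_eRank_lt hlt)
    · have hge : ((n + 1 + 2 : ℕ) : ℕ∞) ≤ M.eRank := not_lt.1 hlt
      apply shadowHall_of_truncate M (by omega : n + 1 < n + 1 + 2)
      apply hrank
      rw [Matroid.eRank_def, PercRepro.Matroid.truncate_ground, PercRepro.Matroid.truncate_eRk_eq_of_ge]
      rw [Matroid.eRk_ground]
      exact hge

end PercRepro.Shadow
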